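import Summits.ResolutionOfSingularities.ResolutionOfSingularities.Theorems.WildQuotientsSummitReductionStubPairOrbitNormalFormBlowupChartsOverCentreChartX
import Summits.ResolutionOfSingularities.ResolutionOfSingularities.Theorems.WildQuotientsSummitReductionStubPairOrbitNormalFormBlowupChartsOverCentreChartT2
import HarnessLib

/-!
# `WildQuotients.SummitReduction` (stmt-ResolutionOfSingularities-16324), line `FramePerfect`, stub NB2
# (`stub_pair_orbitNormalFormBlowup_modelChartsOverCentre`): the regular packages of the charts
# "`u ≠ 0`" and "`t₁ ≠ 0`", generically

Route `ResolutionOfSingularities/WildQuotients`, crux `SummitReduction`; helper file of stub NB2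
(de Jong 1996, 4.27 [C2] on the coefficient-free model). For a regular local ring `R` with a regular
system of parameters `(c, w)`, `c = (c₀, c₁, c₂, c₃)` the centre and `S ⊆ T` index sets of further
branches, the strict transform of `c₀c₁ - c₂c₃ ∏_{k ∈ S} w_k` on the chart `R[𝔓/c_j]` is
`f = (c₀/c_j)(c₁/c_j) - (c₂/c_j)(c₃/c_j) ∏_{k ∈ S} w_k`; at a CLOSED point `𝔔` over `𝔪_R` with local
ring `L` this file packages the marked families of `…ChartsOverCentreChartX/ChartT/ChartT2` into the
uniform shape consumed by `chartsOverCentre_regularCase''` and reads off the regular package of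
`O = L/(f)`: `O` regular, `c̄_j` a non-zero-divisor, the boundary `c₂c₃ ∏_{k ∈ T} w_k = c_j² w'` with
`√((c_j² w') Ô) = (c_j w') Ô` and `(c_j w')` an ideal with local strict normal crossings data
(de Jong 1996, p. 76: chart "`u ≠ 0`": "Clearly, this is smooth and `Z` is given by
`ut₁'t₂'t₃ ⋯ t_r = 0`, a normal crossings divisor"; chart "`t₁ ≠ 0`" off the nodes). The chart
element is given up to an equation `c_j = g` (for the specialisation to the model, where it is a
vector entry).

* `modelChartsOverCentre_isLocalRing_quot`, `modelChartsOverCentre_regular_glue` — bookkeeping;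
* `modelChartsOverCentre_chartX_family`, `modelChartsOverCentre_chartT_family` — the marked families
  (the latter by the case distinction `chartT_uu` / `chartT_tu` / `chartT_tt` on which of
  `c₀/c₂, c₁/c₂` lie in `𝔔`, off the nodes);
* `modelChartsOverCentre_chartX_package`, `modelChartsOverCentre_chartT_package` — the regular packages;
* `modelChartsOverCentre_algebraMap_relation_of_eq` — `F = g² f` with the chart element up to equation.

## Sources

* A. J. de Jong, *Smoothness, semi-stability and alterations*, Publ. Math. IHÉS 83 (1996), 4.27,
  p. 76. [DeJong1996]
-/

set_option linter.dupNamespace false -- the tree's summit namespace repeats `ResolutionOfSingularities`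

noncomputable section

open IsLocalRing
open Literature.AlgebraicGeometry.Resolution

namespace Summit.ResolutionOfSingularities.ResolutionOfSingularities.Theorems

/-- The quotient of a localisation at a prime `𝔔` by an element of `𝔔` is a local ring. [folklore] -/
theorem modelChartsOverCentre_isLocalRing_quot {A L : Type} [CommRing A] [CommRing L] [IsLocalRing L]
    [Algebra A L] (𝔔 : Ideal A) [𝔔.IsPrime] [IsLocalization.AtPrime L 𝔔] {f : A} (hf : f ∈ 𝔔) :
    IsLocalRing (L ⧸ Ideal.span {algebraMap A L f}) := by
  have hfm : algebraMap A L f ∈ maximalIdeal L := by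
    rw [← IsLocalization.AtPrime.map_eq_maximalIdeal 𝔔 L]
    exact Ideal.mem_map_of_mem _ hf
  have hne : Ideal.span {algebraMap A L f} ≠ ⊤ := fun h =>
    (maximalIdeal.isMaximal L).ne_top (top_le_iff.mp (h ▸ (Ideal.span_singleton_le_iff_mem _).mpr hfm))
  haveI : Nontrivial (L ⧸ Ideal.span {algebraMap A L f}) :=
    Ideal.Quotient.nontrivial_iff.mpr hne
  exact IsLocalRing.of_surjective' (Ideal.Quotient.mk _) Ideal.Quotient.mk_surjective

/-- **The regular case from a marked family** (repackaging of `chartsOverCentre_regularCase''` with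
the strict transform `f` and the exceptional generator `G` named): in `O = L/(f)`, regular, `Ḡ` is a
non-zero-divisor and `(J̄) = (Ḡ² w)`, `√((J̄) Ô) = (Ḡ w) Ô`, `(Ḡ w)` with local strict normal
crossings data. [cite: DeJong1996, 4.27, p. 76] -/
theorem modelChartsOverCentre_regular_glue {L : Type} [CommRing L] [IsLocalRing L] (fL G J : L)
    [IsLocalRing (L ⧸ Ideal.span {fL})]
    (h : ∃ (N : ℕ) (Z : Fin N → L) (i_f i₀ : Fin N) (ex : Fin N → ℕ) (U : L),
      i_f ≠ i₀ ∧ IsRsopPart Z ∧ Z i_f = fL ∧ Z i₀ = G ∧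
      ex i₀ = 2 ∧ ex i_f = 0 ∧ (∀ i, i ≠ i₀ → ex i ≤ 1) ∧ IsUnit U ∧
      J - U * ∏ i, Z i ^ ex i ∈ Ideal.span {fL}) :
    IsRegularLocalRing (L ⧸ Ideal.span {fL}) ∧
    Ideal.Quotient.mk (Ideal.span {fL}) G ∈ nonZeroDivisors (L ⧸ Ideal.span {fL}) ∧
    ∃ w : L ⧸ Ideal.span {fL},
      Ideal.span {Ideal.Quotient.mk (Ideal.span {fL}) J} =
        Ideal.span {Ideal.Quotient.mk (Ideal.span {fL}) G ^ 2 * w} ∧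
      ((Ideal.span {Ideal.Quotient.mk (Ideal.span {fL}) J}).map
          (algebraMap (L ⧸ Ideal.span {fL}) (AdicCompletion (maximalIdeal (L ⧸ Ideal.span {fL}))
            (L ⧸ Ideal.span {fL})))).radical =
        (Ideal.span {Ideal.Quotient.mk (Ideal.span {fL}) G * w}).map
          (algebraMap (L ⧸ Ideal.span {fL}) (AdicCompletion (maximalIdeal (L ⧸ Ideal.span {fL}))
            (L ⧸ Ideal.span {fL}))) ∧
      IsSNCIdeal (Ideal.span {Ideal.Quotient.mk (Ideal.span {fL}) G * w}) := by
  obtain ⟨N, Z, i_f, i₀, ex, U, hne, hrs, hZf, hZ0, hex0, hexf, hex1, hU, hJ⟩ := h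
  subst hZf hZ0
  exact chartsOverCentre_regularCase'' hrs i_f i₀ hne ex hex0 hexf hex1 hU hJ

set_option maxHeartbeats 4000000 in
/-- **Chart "`u ≠ 0`": the marked family** of `chartsOverCentre_chartX` in the shape
`(Z, i_f, i₀, ex, U)` — part of a regular system of parameters `Z` of `R[𝔓/c₀]_𝔔` containing the
strict transform `f = Z_{i_f}` and the exceptional generator `c₀ = Z_{i₀}`, exponents with `2` on
`c₀`, `0` on `f`, `≤ 1` elsewhere, and the boundary `c₂c₃ ∏_{k ∈ T} w_k ≡ U ∏ Zᵢ^{exᵢ}` modulo `f`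
(de Jong 1996, p. 76: "`Z` is given by `ut₁'t₂'t₃ ⋯ t_r = 0`, a normal crossings divisor").
[cite: DeJong1996, 4.27, p. 76] -/
theorem modelChartsOverCentre_chartX_family {R : Type} [CommRing R] [IsRegularLocalRing R]
    (c : Fin 4 → R) {l : ℕ} (w : Fin l → R)
    (hz : Ideal.span (Set.range (Fin.append c w)) = maximalIdeal R)
    (hd : (maximalIdeal R).spanFinrank = 4 + l)
    (𝔓 : Ideal R) (h𝔓 : 𝔓 = Ideal.span (Set.range c)) (hc : ∀ k, c k ∈ 𝔓)
    (S T : Finset (Fin l))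
    (𝔔 : Ideal (blowupAlgebra 𝔓 (c 0))) [𝔔.IsMaximal]
    (h𝔔 : 𝔔.comap (algebraMap R _) = maximalIdeal R)
    (L : Type) [CommRing L] [IsLocalRing L] [Algebra (blowupAlgebra 𝔓 (c 0)) L]
    [IsLocalization.AtPrime L 𝔔]
    (hf : blowupAlgebra.gen 𝔓 (c 0) (c 0) (hc 0) * blowupAlgebra.gen 𝔓 (c 0) (c 1) (hc 1) - blowupAlgebra.gen 𝔓 (c 0) (c 2) (hc 2) * blowupAlgebra.gen 𝔓 (c 0) (c 3) (hc 3) * algebraMap R (blowupAlgebra 𝔓 (c 0)) (∏ k ∈ S, w k) ∈ 𝔔) :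
    ∃ (N : ℕ) (Z : Fin N → L) (i_f i₀ : Fin N) (ex : Fin N → ℕ) (U : L),
      i_f ≠ i₀ ∧ IsRsopPart Z ∧ Z i_f = algebraMap (blowupAlgebra 𝔓 (c 0)) L (blowupAlgebra.gen 𝔓 (c 0) (c 0) (hc 0) * blowupAlgebra.gen 𝔓 (c 0) (c 1) (hc 1) - blowupAlgebra.gen 𝔓 (c 0) (c 2) (hc 2) * blowupAlgebra.gen 𝔓 (c 0) (c 3) (hc 3) * algebraMap R (blowupAlgebra 𝔓 (c 0)) (∏ k ∈ S, w k)) ∧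
      Z i₀ = algebraMap (blowupAlgebra 𝔓 (c 0)) L (algebraMap R (blowupAlgebra 𝔓 (c 0)) (c 0)) ∧
      ex i₀ = 2 ∧ ex i_f = 0 ∧ (∀ i, i ≠ i₀ → ex i ≤ 1) ∧ IsUnit U ∧
      algebraMap (blowupAlgebra 𝔓 (c 0)) L (algebraMap R (blowupAlgebra 𝔓 (c 0)) (c 2 * c 3 * ∏ k ∈ T, w k)) - U * ∏ i, Z i ^ ex i ∈
        Ideal.span {algebraMap (blowupAlgebra 𝔓 (c 0)) L (blowupAlgebra.gen 𝔓 (c 0) (c 0) (hc 0) * blowupAlgebra.gen 𝔓 (c 0) (c 1) (hc 1) - blowupAlgebra.gen 𝔓 (c 0) (c 2) (hc 2) * blowupAlgebra.gen 𝔓 (c 0) (c 3) (hc 3) * algebraMap R (blowupAlgebra 𝔓 (c 0)) (∏ k ∈ S, w k))} := by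
  classical
  obtain ⟨a, jJ, ex, U, hrs, hex0, hex1, hU, hJ⟩ :=
    chartsOverCentre_chartX c w hz hd 𝔓 h𝔓 hc S T 𝔔 h𝔔 L hf
  refine ⟨a + l + 1 + 1, _, 0, Fin.succ 0, Fin.cons 0 ex, U, (Fin.succ_ne_zero _).symm, hrs, rfl, ?_, ?_,
    rfl, fun i hi => ?_, hU, ?_⟩
  · rw [Fin.cons_succ, chartsOverCentre_chartFamily_zero]
  · rw [Fin.cons_succ, hex0]
  · induction i using Fin.cases with
    | zero => simp
    | succ i => rw [Fin.cons_succ]; exact hex1 i fun h => hi (by rw [h])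
  · rw [Fin.prod_univ_succ]
    simp only [Fin.cons_zero, Fin.cons_succ, pow_zero, one_mul]
    exact hJ

set_option maxHeartbeats 4000000 in
/-- **Chart "`t₁ ≠ 0`", regular positions: the marked family** — at a closed point of
`R[𝔓/c₂]` over the closed point which is NOT a node of `u'v' = (t₂/t₁) ∏_{k ∈ S} w_k` (i.e. not:
`u/t₁, v/t₁ ∈ 𝔔` with at least two vanishing factors on the right), one of
`chartsOverCentre_chartT_uu/tu/tt` provides a part of a regular system of parameters containing
the strict transform and `c₂`, with the boundary a unit times a monomial modulo `f`
(de Jong 1996, p. 76, chart "`t₁ ≠ 0`": "`Z'` is given by `t₁t₂'t₃ ⋯ t_r = 0`").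
[cite: DeJong1996, 4.27, p. 76] -/
theorem modelChartsOverCentre_chartT_family {R : Type} [CommRing R] [IsRegularLocalRing R]
    (c : Fin 4 → R) {l : ℕ} (w : Fin l → R)
    (hz : Ideal.span (Set.range (Fin.append c w)) = maximalIdeal R)
    (hd : (maximalIdeal R).spanFinrank = 4 + l)
    (𝔓 : Ideal R) (h𝔓 : 𝔓 = Ideal.span (Set.range c)) (hc : ∀ k, c k ∈ 𝔓)
    (S T : Finset (Fin l)) (hST : S ⊆ T)
    (𝔔 : Ideal (blowupAlgebra 𝔓 (c 2))) [𝔔.IsMaximal]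
    (h𝔔 : 𝔔.comap (algebraMap R _) = maximalIdeal R)
    (L : Type) [CommRing L] [IsLocalRing L] [Algebra (blowupAlgebra 𝔓 (c 2)) L]
    [IsLocalization.AtPrime L 𝔔]
    (hf : blowupAlgebra.gen 𝔓 (c 2) (c 0) (hc 0) * blowupAlgebra.gen 𝔓 (c 2) (c 1) (hc 1) - blowupAlgebra.gen 𝔓 (c 2) (c 2) (hc 2) * blowupAlgebra.gen 𝔓 (c 2) (c 3) (hc 3) * algebraMap R (blowupAlgebra 𝔓 (c 2)) (∏ k ∈ S, w k) ∈ 𝔔)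
    (hreg : ¬ (blowupAlgebra.gen 𝔓 (c 2) (c 0) (hc 0) ∈ 𝔔 ∧ blowupAlgebra.gen 𝔓 (c 2) (c 1) (hc 1) ∈ 𝔔 ∧
      ((blowupAlgebra.gen 𝔓 (c 2) (c 3) (hc 3) ∈ 𝔔 ∧ S.Nonempty) ∨ 2 ≤ S.card))) :
    ∃ (N : ℕ) (Z : Fin N → L) (i_f i₀ : Fin N) (ex : Fin N → ℕ) (U : L),
      i_f ≠ i₀ ∧ IsRsopPart Z ∧ Z i_f = algebraMap (blowupAlgebra 𝔓 (c 2)) L (blowupAlgebra.gen 𝔓 (c 2) (c 0) (hc 0) * blowupAlgebra.gen 𝔓 (c 2) (c 1) (hc 1) - blowupAlgebra.gen 𝔓 (c 2) (c 2) (hc 2) * blowupAlgebra.gen 𝔓 (c 2) (c 3) (hc 3) * algebraMap R (blowupAlgebra 𝔓 (c 2)) (∏ k ∈ S, w k)) ∧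
      Z i₀ = algebraMap (blowupAlgebra 𝔓 (c 2)) L (algebraMap R (blowupAlgebra 𝔓 (c 2)) (c 2)) ∧
      ex i₀ = 2 ∧ ex i_f = 0 ∧ (∀ i, i ≠ i₀ → ex i ≤ 1) ∧ IsUnit U ∧
      algebraMap (blowupAlgebra 𝔓 (c 2)) L (algebraMap R (blowupAlgebra 𝔓 (c 2)) (c 2 * c 3 * ∏ k ∈ T, w k)) - U * ∏ i, Z i ^ ex i ∈
        Ideal.span {algebraMap (blowupAlgebra 𝔓 (c 2)) L (blowupAlgebra.gen 𝔓 (c 2) (c 0) (hc 0) * blowupAlgebra.gen 𝔓 (c 2) (c 1) (hc 1) - blowupAlgebra.gen 𝔓 (c 2) (c 2) (hc 2) * blowupAlgebra.gen 𝔓 (c 2) (c 3) (hc 3) * algebraMap R (blowupAlgebra 𝔓 (c 2)) (∏ k ∈ S, w k))} := by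
  classical
  by_cases h0 : blowupAlgebra.gen 𝔓 (c 2) (c 0) (hc 0) ∈ 𝔔
  · by_cases h1 : blowupAlgebra.gen 𝔓 (c 2) (c 1) (hc 1) ∈ 𝔔
    · have hν : (blowupAlgebra.gen 𝔓 (c 2) (c 3) (hc 3) ∈ 𝔔 → S = ∅) ∧ S.card ≤ 1 := by
        constructor
        · intro h3
          by_contra hS
          exact hreg ⟨h0, h1, Or.inl ⟨h3, Finset.nonempty_iff_ne_empty.mpr hS⟩⟩
        · by_contra hS
          exact hreg ⟨h0, h1, Or.inr (by omega)⟩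
      exact chartsOverCentre_chartT_tt c w hz hd 𝔓 h𝔓 hc S T 𝔔 h𝔔 L hf hST h0 h1 hν
    · exact chartsOverCentre_chartT_tu c w hz hd 𝔓 h𝔓 hc S T 𝔔 h𝔔 L hf ⟨0, by decide⟩ ⟨1, by decide⟩
        (by decide) rfl h0 h1
  · by_cases h1 : blowupAlgebra.gen 𝔓 (c 2) (c 1) (hc 1) ∈ 𝔔
    · exact chartsOverCentre_chartT_tu c w hz hd 𝔓 h𝔓 hc S T 𝔔 h𝔔 L hf ⟨1, by decide⟩ ⟨0, by decide⟩
        (by decide) (mul_comm _ _) h1 h0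
    · exact chartsOverCentre_chartT_uu c w hz hd 𝔓 h𝔓 hc S T 𝔔 h𝔔 L hf h0 h1

set_option maxHeartbeats 4000000 in
/-- **Chart "`u ≠ 0`" at a closed point over the closed point: the regular package** (the chart
element `c₀ = g` given up to an equation, for specialisation to the model) — `O = L/(f)` is
regular, `ḡ` is a non-zero-divisor, the boundary is `g² w'` with `√((g² w') Ô) = (g w') Ô` and
`(g w')` an ideal with local strict normal crossings data (de Jong 1996, p. 76: "Clearly, this is
smooth and `Z` is given by `ut₁'t₂'t₃ ⋯ t_r = 0`, a normal crossings divisor").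
[cite: DeJong1996, 4.27, p. 76] -/
theorem modelChartsOverCentre_chartX_package {R : Type} [CommRing R] [IsRegularLocalRing R]
    (c : Fin 4 → R) {l : ℕ} (w : Fin l → R)
    (hz : Ideal.span (Set.range (Fin.append c w)) = maximalIdeal R)
    (hd : (maximalIdeal R).spanFinrank = 4 + l)
    (𝔓 : Ideal R) (h𝔓 : 𝔓 = Ideal.span (Set.range c)) (hc : ∀ k, c k ∈ 𝔓)
    (S T : Finset (Fin l)) (g : R) (hg : c 0 = g)
    (𝔔 : Ideal (blowupAlgebra 𝔓 g)) [𝔔.IsMaximal]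
    (h𝔔 : 𝔔.comap (algebraMap R _) = maximalIdeal R)
    (L : Type) [CommRing L] [IsLocalRing L] [Algebra (blowupAlgebra 𝔓 g) L]
    [IsLocalization.AtPrime L 𝔔]
    (hf : blowupAlgebra.gen 𝔓 g (c 0) (hc 0) * blowupAlgebra.gen 𝔓 g (c 1) (hc 1) - blowupAlgebra.gen 𝔓 g (c 2) (hc 2) * blowupAlgebra.gen 𝔓 g (c 3) (hc 3) * algebraMap R (blowupAlgebra 𝔓 g) (∏ k ∈ S, w k) ∈ 𝔔) [IsLocalRing (L ⧸ Ideal.span {algebraMap (blowupAlgebra 𝔓 g) L (blowupAlgebra.gen 𝔓 g (c 0) (hc 0) * blowupAlgebra.gen 𝔓 g (c 1) (hc 1) - blowupAlgebra.gen 𝔓 g (c 2) (hc 2) * blowupAlgebra.gen 𝔓 g (c 3) (hc 3) * algebraMap R (blowupAlgebra 𝔓 g) (∏ k ∈ S, w k))})] :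
    IsRegularLocalRing (L ⧸ Ideal.span {algebraMap (blowupAlgebra 𝔓 g) L (blowupAlgebra.gen 𝔓 g (c 0) (hc 0) * blowupAlgebra.gen 𝔓 g (c 1) (hc 1) - blowupAlgebra.gen 𝔓 g (c 2) (hc 2) * blowupAlgebra.gen 𝔓 g (c 3) (hc 3) * algebraMap R (blowupAlgebra 𝔓 g) (∏ k ∈ S, w k))}) ∧
    Ideal.Quotient.mk (Ideal.span {algebraMap (blowupAlgebra 𝔓 g) L (blowupAlgebra.gen 𝔓 g (c 0) (hc 0) * blowupAlgebra.gen 𝔓 g (c 1) (hc 1) - blowupAlgebra.gen 𝔓 g (c 2) (hc 2) * blowupAlgebra.gen 𝔓 g (c 3) (hc 3) * algebraMap R (blowupAlgebra 𝔓 g) (∏ k ∈ S, w k))}) (algebraMap (blowupAlgebra 𝔓 g) L (algebraMap R (blowupAlgebra 𝔓 g) (g))) ∈ nonZeroDivisors (L ⧸ Ideal.span {algebraMap (blowupAlgebra 𝔓 g) L (blowupAlgebra.gen 𝔓 g (c 0) (hc 0) * blowupAlgebra.gen 𝔓 g (c 1) (hc 1) - blowupAlgebra.gen 𝔓 g (c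 2) (hc 2) * blowupAlgebra.gen 𝔓 g (c 3) (hc 3) * algebraMap R (blowupAlgebra 𝔓 g) (∏ k ∈ S, w k))}) ∧
    ∃ w' : (L ⧸ Ideal.span {algebraMap (blowupAlgebra 𝔓 g) L (blowupAlgebra.gen 𝔓 g (c 0) (hc 0) * blowupAlgebra.gen 𝔓 g (c 1) (hc 1) - blowupAlgebra.gen 𝔓 g (c 2) (hc 2) * blowupAlgebra.gen 𝔓 g (c 3) (hc 3) * algebraMap R (blowupAlgebra 𝔓 g) (∏ k ∈ S, w k))}),
      Ideal.span {Ideal.Quotient.mk (Ideal.span {algebraMap (blowupAlgebra 𝔓 g) L (blowupAlgebra.gen 𝔓 g (c 0) (hc 0) * blowupAlgebra.gen 𝔓 g (c 1) (hc 1) - blowupAlgebra.gen 𝔓 g (c 2) (hc 2) * blowupAlgebra.gen 𝔓 g (c 3) (hc 3) * algebraMap R (blowupAlgebra 𝔓 g) (∏ k ∈ S, w k))}) (algebraMap (blowupAlgebra 𝔓 g) L (algebraMap R (blowupAlgebra 𝔓 g) (c 2 * c 3 * ∏ k ∈ T, w k)))} = Ideal.span {Ideal.Quotient.mk (Ideal.span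 {algebraMap (blowupAlgebra 𝔓 g) L (blowupAlgebra.gen 𝔓 g (c 0) (hc 0) * blowupAlgebra.gen 𝔓 g (c 1) (hc 1) - blowupAlgebra.gen 𝔓 g (c 2) (hc 2) * blowupAlgebra.gen 𝔓 g (c 3) (hc 3) * algebraMap R (blowupAlgebra 𝔓 g) (∏ k ∈ S, w k))}) (algebraMap (blowupAlgebra 𝔓 g) L (algebraMap R (blowupAlgebra 𝔓 g) (g))) ^ 2 * w'} ∧
      ((Ideal.span {Ideal.Quotient.mk (Ideal.span {algebraMap (blowupAlgebra 𝔓 g) L (blowupAlgebra.gen 𝔓 g (c 0) (hc 0) * blowupAlgebra.gen 𝔓 g (c 1) (hc 1) - blowupAlgebra.gen 𝔓 g (c 2) (hc 2) * blowupAlgebra.gen 𝔓 g (c 3) (hc 3) * algebraMap R (blowupAlgebra 𝔓 g) (∏ k ∈ S, w k))}) (algebraMap (blowupAlgebra 𝔓 g) L (algebraMap R (blowupAlgebra 𝔓 g) (c 2 * c 3 * ∏ k ∈ T, w k)))}).map (algebraMap (L ⧸ Ideal.span {algebraMap (blowupAlgebra 𝔓 g) L (blowupAlgebra.gen 𝔓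 g (c 0) (hc 0) * blowupAlgebra.gen 𝔓 g (c 1) (hc 1) - blowupAlgebra.gen 𝔓 g (c 2) (hc 2) * blowupAlgebra.gen 𝔓 g (c 3) (hc 3) * algebraMap R (blowupAlgebra 𝔓 g) (∏ k ∈ S, w k))}) (AdicCompletion (maximalIdeal (L ⧸ Ideal.span {algebraMap (blowupAlgebra 𝔓 g) L (blowupAlgebra.gen 𝔓 g (c 0) (hc 0) * blowupAlgebra.gen 𝔓 g (c 1) (hc 1) - blowupAlgebra.gen 𝔓 g (c 2) (hc 2) * blowupAlgebra.gen 𝔓 g (c 3) (hc 3) * algebraMap R (blowupAlgebra 𝔓 g) (∏ k ∈ S, w k))})) (L ⧸ Ideal.span {algebraMap (blowupAlgebra 𝔓 g) L (blowupAlgebra.gen 𝔓 g (c 0) (hc 0) * blowupAlgebra.gen 𝔓 g (c 1) (hc 1) - blowupAlgebra.gen 𝔓 g (c 2) (hc 2) * blowupAlgebra.gen 𝔓 g (c 3) (hc 3) * algebraMap R (blowupAlgebra 𝔓 g) (∏ k ∈ S, w k))})))).radical =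
        (Ideal.span {Ideal.Quotient.mk (Ideal.span {algebraMap (blowupAlgebra 𝔓 g) L (blowupAlgebra.gen 𝔓 g (c 0) (hc 0) * blowupAlgebra.gen 𝔓 g (c 1) (hc 1) - blowupAlgebra.gen 𝔓 g (c 2) (hc 2) * blowupAlgebra.gen 𝔓 g (c 3) (hc 3) * algebraMap R (blowupAlgebra 𝔓 g) (∏ k ∈ S, w k))}) (algebraMap (blowupAlgebra 𝔓 g) L (algebraMap R (blowupAlgebra 𝔓 g) (g))) * w'}).map (algebraMap (L ⧸ Ideal.span {algebraMap (blowupAlgebra 𝔓 g) L (blowupAlgebra.gen 𝔓 g (c 0) (hc 0) * blowupAlgebra.gen 𝔓 g (c 1) (hc 1) - blowupAlgebra.gen 𝔓 g (c 2) (hc 2) * blowupAlgebra.gen 𝔓 g (c 3) (hc 3) * algebraMap R (blowupAlgebra 𝔓 g) (∏ k ∈ S, w k))}) (AdicCompletion (maximalIdeal (L ⧸ Ideal.span {algebraMap (blowupAlgebra 𝔓 g) L (blowupAlgebra.gen 𝔓 g (c 0) (hc 0) * blowupAlgebra.gen 𝔓 g (c 1) (hc 1) - blowupAlgebra.gen 𝔓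 g (c 2) (hc 2) * blowupAlgebra.gen 𝔓 g (c 3) (hc 3) * algebraMap R (blowupAlgebra 𝔓 g) (∏ k ∈ S, w k))})) (L ⧸ Ideal.span {algebraMap (blowupAlgebra 𝔓 g) L (blowupAlgebra.gen 𝔓 g (c 0) (hc 0) * blowupAlgebra.gen 𝔓 g (c 1) (hc 1) - blowupAlgebra.gen 𝔓 g (c 2) (hc 2) * blowupAlgebra.gen 𝔓 g (c 3) (hc 3) * algebraMap R (blowupAlgebra 𝔓 g) (∏ k ∈ S, w k))}))) ∧
      IsSNCIdeal (Ideal.span {Ideal.Quotient.mk (Ideal.span {algebraMap (blowupAlgebra 𝔓 g) L (blowupAlgebra.gen 𝔓 g (c 0) (hc 0) * blowupAlgebra.gen 𝔓 g (c 1) (hc 1) - blowupAlgebra.gen 𝔓 g (c 2) (hc 2) * blowupAlgebra.gen 𝔓 g (c 3) (hc 3) * algebraMap R (blowupAlgebra 𝔓 g) (∏ k ∈ S, w k))}) (algebraMap (blowupAlgebra 𝔓 g) L (algebraMap R (blowupAlgebra 𝔓 g) (g))) * w'}) := by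
  subst hg
  exact modelChartsOverCentre_regular_glue _ _ _
    (modelChartsOverCentre_chartX_family c w hz hd 𝔓 h𝔓 hc S T 𝔔 h𝔔 L hf)

set_option maxHeartbeats 4000000 in
/-- **Chart "`t₁ ≠ 0`" at a closed point over the closed point in regular position: the regular
package** (the chart element `c₂ = g` given up to an equation) — `O = L/(f)` is regular, `ḡ` is
a non-zero-divisor, the boundary is `g² w'` with `√((g² w') Ô) = (g w') Ô` and `(g w')` an ideal
with local strict normal crossings data (de Jong 1996, p. 76, chart "`t₁ ≠ 0`" off the nodes:
"`Z'` is given by `t₁t₂'t₃ ⋯ t_r = 0`"). [cite: DeJong1996, 4.27, p. 76] -/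
theorem modelChartsOverCentre_chartT_package {R : Type} [CommRing R] [IsRegularLocalRing R]
    (c : Fin 4 → R) {l : ℕ} (w : Fin l → R)
    (hz : Ideal.span (Set.range (Fin.append c w)) = maximalIdeal R)
    (hd : (maximalIdeal R).spanFinrank = 4 + l)
    (𝔓 : Ideal R) (h𝔓 : 𝔓 = Ideal.span (Set.range c)) (hc : ∀ k, c k ∈ 𝔓)
    (S T : Finset (Fin l)) (hST : S ⊆ T) (g : R) (hg : c 2 = g)
    (𝔔 : Ideal (blowupAlgebra 𝔓 g)) [𝔔.IsMaximal]
    (h𝔔 : 𝔔.comap (algebraMap R _) = maximalIdeal R)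
    (L : Type) [CommRing L] [IsLocalRing L] [Algebra (blowupAlgebra 𝔓 g) L]
    [IsLocalization.AtPrime L 𝔔]
    (hf : blowupAlgebra.gen 𝔓 g (c 0) (hc 0) * blowupAlgebra.gen 𝔓 g (c 1) (hc 1) - blowupAlgebra.gen 𝔓 g (c 2) (hc 2) * blowupAlgebra.gen 𝔓 g (c 3) (hc 3) * algebraMap R (blowupAlgebra 𝔓 g) (∏ k ∈ S, w k) ∈ 𝔔)
    (hreg : ¬ (blowupAlgebra.gen 𝔓 g (c 0) (hc 0) ∈ 𝔔 ∧ blowupAlgebra.gen 𝔓 g (c 1) (hc 1) ∈ 𝔔 ∧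
      ((blowupAlgebra.gen 𝔓 g (c 3) (hc 3) ∈ 𝔔 ∧ S.Nonempty) ∨ 2 ≤ S.card)))
    [IsLocalRing (L ⧸ Ideal.span {algebraMap (blowupAlgebra 𝔓 g) L (blowupAlgebra.gen 𝔓 g (c 0) (hc 0) * blowupAlgebra.gen 𝔓 g (c 1) (hc 1) - blowupAlgebra.gen 𝔓 g (c 2) (hc 2) * blowupAlgebra.gen 𝔓 g (c 3) (hc 3) * algebraMap R (blowupAlgebra 𝔓 g) (∏ k ∈ S, w k))})] :
    IsRegularLocalRing (L ⧸ Ideal.span {algebraMap (blowupAlgebra 𝔓 g) L (blowupAlgebra.gen 𝔓 g (c 0) (hc 0) * blowupAlgebra.gen 𝔓 g (c 1) (hc 1) - blowupAlgebra.gen 𝔓 g (c 2) (hc 2) * blowupAlgebra.gen 𝔓 g (c 3) (hc 3) * algebraMap R (blowupAlgebra 𝔓 g) (∏ k ∈ S, w k))}) ∧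
    Ideal.Quotient.mk (Ideal.span {algebraMap (blowupAlgebra 𝔓 g) L (blowupAlgebra.gen 𝔓 g (c 0) (hc 0) * blowupAlgebra.gen 𝔓 g (c 1) (hc 1) - blowupAlgebra.gen 𝔓 g (c 2) (hc 2) * blowupAlgebra.gen 𝔓 g (c 3) (hc 3) * algebraMap R (blowupAlgebra 𝔓 g) (∏ k ∈ S, w k))}) (algebraMap (blowupAlgebra 𝔓 g) L (algebraMap R (blowupAlgebra 𝔓 g) (g))) ∈ nonZeroDivisors (L ⧸ Ideal.span {algebraMap (blowupAlgebra 𝔓 g) L (blowupAlgebra.gen 𝔓 g (c 0) (hc 0) * blowupAlgebra.gen 𝔓 g (c 1) (hc 1) - blowupAlgebra.gen 𝔓 g (c 2) (hc 2) * blowupAlgebra.gen 𝔓 g (c 3) (hc 3) * algebraMap R (blowupAlgebra 𝔓 g) (∏ k ∈ S, w k))}) ∧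
    ∃ w' : (L ⧸ Ideal.span {algebraMap (blowupAlgebra 𝔓 g) L (blowupAlgebra.gen 𝔓 g (c 0) (hc 0) * blowupAlgebra.gen 𝔓 g (c 1) (hc 1) - blowupAlgebra.gen 𝔓 g (c 2) (hc 2) * blowupAlgebra.gen 𝔓 g (c 3) (hc 3) * algebraMap R (blowupAlgebra 𝔓 g) (∏ k ∈ S, w k))}),
      Ideal.span {Ideal.Quotient.mk (Ideal.span {algebraMap (blowupAlgebra 𝔓 g) L (blowupAlgebra.gen 𝔓 g (c 0) (hc 0) * blowupAlgebra.gen 𝔓 g (c 1) (hc 1) - blowupAlgebra.gen 𝔓 g (c 2) (hc 2) * blowupAlgebra.gen 𝔓 g (c 3) (hc 3) * algebraMap R (blowupAlgebra 𝔓 g) (∏ k ∈ S, w k))}) (algebraMap (blowupAlgebra 𝔓 g) L (algebraMap R (blowupAlgebra 𝔓 g) (c 2 * c 3 * ∏ k ∈ T, w k)))} = Ideal.span {Ideal.Quotient.mk (Ideal.span {algebraMap (blowupAlgebra 𝔓 g) L (blowupAlgebra.gen 𝔓 g (c 0) (hc 0) * blowupAlgebra.gen 𝔓 g (c 1) (hc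 1) - blowupAlgebra.gen 𝔓 g (c 2) (hc 2) * blowupAlgebra.gen 𝔓 g (c 3) (hc 3) * algebraMap R (blowupAlgebra 𝔓 g) (∏ k ∈ S, w k))}) (algebraMap (blowupAlgebra 𝔓 g) L (algebraMap R (blowupAlgebra 𝔓 g) (g))) ^ 2 * w'} ∧
      ((Ideal.span {Ideal.Quotient.mk (Ideal.span {algebraMap (blowupAlgebra 𝔓 g) L (blowupAlgebra.gen 𝔓 g (c 0) (hc 0) * blowupAlgebra.gen 𝔓 g (c 1) (hc 1) - blowupAlgebra.gen 𝔓 g (c 2) (hc 2) * blowupAlgebra.gen 𝔓 g (c 3) (hc 3) * algebraMap R (blowupAlgebra 𝔓 g) (∏ k ∈ S, w k))}) (algebraMap (blowupAlgebra 𝔓 g) L (algebraMap R (blowupAlgebra 𝔓 g) (c 2 * c 3 * ∏ k ∈ T, w k)))}).map (algebraMap (L ⧸ Ideal.span {algebraMap (blowupAlgebra 𝔓 g) L (blowupAlgebra.gen 𝔓 g (c 0) (hc 0) * blowupAlgebra.gen 𝔓 g (c 1) (hc 1) - blowupAlgebra.gen 𝔓 g (c 2) (hc 2) * blowupAlgebra.gen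 𝔓 g (c 3) (hc 3) * algebraMap R (blowupAlgebra 𝔓 g) (∏ k ∈ S, w k))}) (AdicCompletion (maximalIdeal (L ⧸ Ideal.span {algebraMap (blowupAlgebra 𝔓 g) L (blowupAlgebra.gen 𝔓 g (c 0) (hc 0) * blowupAlgebra.gen 𝔓 g (c 1) (hc 1) - blowupAlgebra.gen 𝔓 g (c 2) (hc 2) * blowupAlgebra.gen 𝔓 g (c 3) (hc 3) * algebraMap R (blowupAlgebra 𝔓 g) (∏ k ∈ S, w k))})) (L ⧸ Ideal.span {algebraMap (blowupAlgebra 𝔓 g) L (blowupAlgebra.gen 𝔓 g (c 0) (hc 0) * blowupAlgebra.gen 𝔓 g (c 1) (hc 1) - blowupAlgebra.gen 𝔓 g (c 2) (hc 2) * blowupAlgebra.gen 𝔓 g (c 3) (hc 3) * algebraMap R (blowupAlgebra 𝔓 g) (∏ k ∈ S, w k))})))).radical =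
        (Ideal.span {Ideal.Quotient.mk (Ideal.span {algebraMap (blowupAlgebra 𝔓 g) L (blowupAlgebra.gen 𝔓 g (c 0) (hc 0) * blowupAlgebra.gen 𝔓 g (c 1) (hc 1) - blowupAlgebra.gen 𝔓 g (c 2) (hc 2) * blowupAlgebra.gen 𝔓 g (c 3) (hc 3) * algebraMap R (blowupAlgebra 𝔓 g) (∏ k ∈ S, w k))}) (algebraMap (blowupAlgebra 𝔓 g) L (algebraMap R (blowupAlgebra 𝔓 g) (g))) * w'}).map (algebraMap (L ⧸ Ideal.span {algebraMap (blowupAlgebra 𝔓 g) L (blowupAlgebra.gen 𝔓 g (c 0) (hc 0) * blowupAlgebra.gen 𝔓 g (c 1) (hc 1) - blowupAlgebra.gen 𝔓 g (c 2) (hc 2) * blowupAlgebra.gen 𝔓 g (c 3) (hc 3) * algebraMap R (blowupAlgebra 𝔓 g) (∏ k ∈ S, w k))}) (AdicCompletion (maximalIdeal (L ⧸ Ideal.span {algebraMap (blowupAlgebra 𝔓 g) L (blowupAlgebra.gen 𝔓 g (c 0) (hc 0) * blowupAlgebra.gen 𝔓 g (c 1) (hc 1) - blowupAlgebra.gen 𝔓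 g (c 2) (hc 2) * blowupAlgebra.gen 𝔓 g (c 3) (hc 3) * algebraMap R (blowupAlgebra 𝔓 g) (∏ k ∈ S, w k))})) (L ⧸ Ideal.span {algebraMap (blowupAlgebra 𝔓 g) L (blowupAlgebra.gen 𝔓 g (c 0) (hc 0) * blowupAlgebra.gen 𝔓 g (c 1) (hc 1) - blowupAlgebra.gen 𝔓 g (c 2) (hc 2) * blowupAlgebra.gen 𝔓 g (c 3) (hc 3) * algebraMap R (blowupAlgebra 𝔓 g) (∏ k ∈ S, w k))}))) ∧
      IsSNCIdeal (Ideal.span {Ideal.Quotient.mk (Ideal.span {algebraMap (blowupAlgebra 𝔓 g) L (blowupAlgebra.gen 𝔓 g (c 0) (hc 0) * blowupAlgebra.gen 𝔓 g (c 1) (hc 1) - blowupAlgebra.gen 𝔓 g (c 2) (hc 2) * blowupAlgebra.gen 𝔓 g (c 3) (hc 3) * algebraMap R (blowupAlgebra 𝔓 g) (∏ k ∈ S, w k))}) (algebraMap (blowupAlgebra 𝔓 g) L (algebraMap R (blowupAlgebra 𝔓 g) (g))) * w'}) := by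
  subst hg
  exact modelChartsOverCentre_regular_glue _ _ _
    (modelChartsOverCentre_chartT_family c w hz hd 𝔓 h𝔓 hc S T hST 𝔔 h𝔔 L hf hreg)

/-- `chartsOverCentre_algebraMap_relation` with the chart element given up to an equation:
`F = c₀c₁ - c₂c₃H = g² f` in `R[𝔓/g]`, `g = c_j`. [cite: DeJong1996, 4.27, p. 76] -/
theorem modelChartsOverCentre_algebraMap_relation_of_eq {R : Type} [CommRing R] (c : Fin 4 → R)
    (𝔓 : Ideal R) (hc : ∀ k, c k ∈ 𝔓) (j : Fin 4) (g : R) (hg : c j = g) (H : R) :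
    algebraMap R (blowupAlgebra 𝔓 g) (c 0 * c 1 - c 2 * c 3 * H) =
      algebraMap R (blowupAlgebra 𝔓 g) g ^ 2 *
        (blowupAlgebra.gen 𝔓 g (c 0) (hc 0) * blowupAlgebra.gen 𝔓 g (c 1) (hc 1) -
          blowupAlgebra.gen 𝔓 g (c 2) (hc 2) * blowupAlgebra.gen 𝔓 g (c 3) (hc 3) *
            algebraMap R (blowupAlgebra 𝔓 g) H) := by
  subst hg
  exact chartsOverCentre_algebraMap_relation c 𝔓 hc j H

end Summit.ResolutionOfSingularities.ResolutionOfSingularities.Theorems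

end
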